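/-
Copyright (c) 2026 the pub-hodgecm-mathlib formalisation cell (harness21).  Prover seat hodgecm-mathlib-R90-C10-p03 (g2), SLAB R90-TF, section S1 «Ch. 10∕12 local»;
crux H413 = `stmt-HodgeConjecture-24833`; line «B_pos» RAMIFIED TAME corner (B-10), card (6d-R) (dealer R90-C10-plan (g3) 2026-09-05T02:27:40Z; letter bytes of
R90-C10-p01 (g3) 02:28:49Z): «THE (R-b) LETTER OF RECORD» — the L2∕L3 → L4 seam of ruling R-S1-27: ★ (6d)'s shell law with its three fibre-row letters DISCHARGED BY NAME
from (6e), at the ONE-CURRENCY scaling unit `σΠ·Π` and the tame base constant `½`.  KERNEL module: THEOREMS ONLY (no definition, no named fact, no `sorry`, no instance,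
no notation).  2026-09-05.
-/
import Summits.HodgeConjecture.HodgeConjecture.Theorems.R90S1BposRamOddShellValues      -- ★ p864575 (6d) (this seat): `evenShells_zero_and_exists_const_oddShells_of_rows` (heven ∧ ∃ C, hodd ∧ hC2 over the row letters); brings ★ (B) p864346
import Summits.HodgeConjecture.HodgeConjecture.Theorems.R90S1BposRamFibreRows           -- (6e) (R90-C10-p07 (g2)): `fibreRows_hi ∕ fibreRows_mid ∕ fibreRows_lo` (the three rows in ★ (B)'s binder shapes); brings ★ (6b) P1 `scalingUnit_letters_conj_mul_ram`, FILE 2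
import Summits.HodgeConjecture.HodgeConjecture.Theorems.R90S1BposRamFixedPrincipalUnits  -- ★ p863838 (B-10)(1) (R90-C10-p08 (g2)): `apply_eq_one_of_branchB_of_fixed_principal_ram` (Branch B ⇒ `χ₁ = 1` on the σ-fixed principal units = the letter `hfixP`)
import HarnessLib

/-!
# R90-TF S1 «Ch10-local» ∕ K2 E3 «U4Keys» :182, BRANCH B AT POSITIVE DEPTH, RAMIFIED TAME corner — card (6d-R): THE (R-b) LETTER OF RECORD `hRb`
# «at `l = σΠ·Π`, `c = ½`: even cut shells `0`, odd cut shells `C·X^{κ+1}`, `C²·X = (q^ν·μ(B(ν,0)))²·((q−1)²·(q^{2ν+1})⁻¹)`, GIVEN ONLY the level-one sphere values (deep `0`, critical `Φcrit`,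
# shallow `0`) and the Gauss square `Φcrit²·X = q⁻¹·μ⁻(𝒪⁻)²`» [Keys1984 §4–§5, §7 Thm (2) (d); Casselman1980 §3; Rogawski1990 §1.10, §12.2 (2); WeilBNT1967 Ch. II §5]

Cell `pub/hodgecm-mathlib`, crux H413 = `stmt-HodgeConjecture-24833`, route of record `HCCMUnconditional` (no route verbs); R90-TF section S1 (base R90-C10), dealer
R90-C10-plan (g3) (deal 02:27:40Z; rulings R-S1-27 «four layers», R-S1-29 «(6a-G) split»), line lead R90-C10-p05 (g2), auditor R90-C10-audit1 (g3), junction keeper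
R90-C10-typ1 (g5) (seams S-a∕S-b).  THEOREMS ONLY; lane `--supports stmt-HodgeConjecture-24833 --as helper`, count-neutral.  NOT THE PAYER of :182: this file is the letter
`hRb` of the (8⁺b) payer `HEram_of_layers (hRa) (hRb)` (R90-C10-p01 (g3) 02:28:49Z), TOKEN FOR TOKEN.

THE POINT.  ★ (6d) `R90S1BposRamOddShellValues.evenShells_zero_and_exists_const_oddShells_of_rows` is the ramified shell law HYPOTHESIS-FIRST on ★ (B)'s three fibre rows
(`hfib_hi ∕ hfib_mid ∕ hfib_lo` at `N := m + 1`, explicit row values `A j`, `B j`) for an arbitrary scaling scalar `X`, base constant `c` and sphere letters `Φdeep Φcrit`.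
(6e) `R90S1BposRamFibreRows.fibreRows_hi ∕ _mid ∕ _lo` (R90-C10-p07 (g2)) PROVE those rows from the σ-fixed level-one sphere values along the base family
`a′ = lᵗ·(−(xσx)·c)`.  HERE the two are composed at the currency of record — `l := σΠ·Π = Units.map σ piU * piU` (★ (6b) P1 §0′ `scalingUnit_letters_conj_mul_ram`:
`σl = l`, `|l_w| = e⁻²`, `‖l‖_R = (q²)⁻¹`; junction word J1), `X := χ₁(σΠ·Π)` (ONE CURRENCY RULE, ★ (7) p864034's bytes), `c := ½` (`σ½ = ½` ★ `HeisRing.map_invOf_two`,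
`½ + ½ = 1`, `|½|_w = 1` ★ `valued_invOf_two_apply`; junction word J4), Branch B `hB` ⇒ `hfixP` (★ p863838), `Φdeep := 0` — so that EXACTLY the four VALUE LETTERS of
ruling R-S1-29 remain: `hΦdeep` (deep levels `≤ |ϖ|^{m+2}`: `Φ = 0`; (6a) PART 3 (G3)), `hΦcritC` (critical level `|ϖ|^{m+1}`: `Φ = Φcrit`; (6a-G)(β) via ★ (G1) p864588 + `hB`),
`hΦsh` (shallow levels `|ϖ|^{m+1} < · ≤ |ϖ|²`: `Φ = 0`; (6a-G)(α) (G4)), `hΦcrit` (`Φcrit²·X = q⁻¹·μ⁻{|y|_w ≤ 1}²`; (6a-G)(β) (G2)) — each over an auxiliary regular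
additive Haar measure `μ⁻` (`μY`) of `R⁻`, the measure in which (6a) states them.
* §1 **`shellLaw_of_values`** — frame `(L v w hw) (hns) (he) (h2w) {ϖ} (hϖ) (χ₁ h₁ hcontr hB) (piU hpiU) {m ν} (hm) (hνν) (u₁ hu₁ hχu₁) [Invertible 2] [Borel R] (μY) [Borel N] (μ)
  (Φcrit) (hΦdeep hΦcritC hΦsh hΦcrit)` ⊢ **`(∀ j₀ j, j₀ ≤ j → Even j → ∫_{Sh_j ∩ cut ν} F₀ dμ = 0) ∧ ∃ C, (∀ j κ, j = 2κ+1 → ∫_{Sh_j ∩ cut ν} F₀ dμ = C·X^{κ+1}) ∧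
  C²·X = (q^ν·μ(B(ν,0)))²·((q−1)²·(q^{2ν+1})⁻¹)`** = ★ (6d) §2's conclusion bytes at `X := χ₁(σΠ·Π)` = R90-C10-p01 (g3)'s `hRb` (02:28:49Z) VERBATIM.
HONEST LABEL.  HC_CM is proved only modulo the 7 printed citations (2 remaining named inputs: hLiu418 = `stmt-HodgeConjecture-24832`, h413 = `stmt-HodgeConjecture-24833`) until
rung 0 closes; count-neutral — this file pays NO socket (:182 ∕ (S-RT) ∕ A2′ OPEN); no printed citation is discharged; the four sphere-value letters are paid by (6a) PART 3 ∕
(6a-G); REL ≠ ★ ≠ BUILT.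

## References
* [Keys1984] D. Keys, *Principal series representations of special unitary groups over local fields*, Compositio Math. 51 (1984), §4–§5, §7 Theorem (2) (d) p. 126.
* [Casselman1980] W. Casselman, *The unramified principal series of p-adic groups I*, Compositio Math. 40 (1980), §3.
* [Rogawski1990] J. D. Rogawski, *Automorphic Representations of Unitary Groups in Three Variables*, Ann. of Math. Stud. 123 (1990), §1.10 p. 9, §12.2 (2) p. 173.
* [WeilBNT1967] A. Weil, *Basic Number Theory* (1967), Ch. I §4, Ch. II §5.
-/

set_option autoImplicit false
set_option linter.dupNamespace false  -- the mandated namespace has the single-problem summit's repeated segment (`HodgeConjecture.HodgeConjecture`)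

noncomputable section

open NumberField IsDedekindDomain MeasureTheory Measure Literature.NumberTheory Literature.NumberTheory.Automorphic Literature.NumberTheory.Automorphic.UnitaryGroup
open scoped Matrix MatrixGroups WithZero Valued NNReal ENNReal

namespace Summit.HodgeConjecture.HodgeConjecture.R90.S1.BposRamShellLawOfRecord

open Summit.HodgeConjecture.HodgeConjecture.Cruxes.H413 Summit.HodgeConjecture.HodgeConjecture.R90.S1

-- the statements carry the frame-v1 Casselman integrand on the matrix-group carrier of `N(L⁺_v)`: generous budgets for the whole module (class of ★ (B) ∕ ★ (6d))
set_option synthInstance.maxHeartbeats 400000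
set_option maxHeartbeats 6000000

variable (L : Type) [Field L] [NumberField L] [IsCMField L] (v : HeightOneSpectrum (𝓞 ↥(maximalRealSubfield L)))
  (w : PlacesOver L v) (hw : IsCMField.complexConj L • w.1 = w.1)

/-! ## §1 The (R-b) letter of record: ★ (6d) ∘ (6e) at `l = σΠ·Π`, `c = ½`, `Φdeep = 0` -/

set_option linter.overlappingInstances false in  -- `[μY.IsAddHaarMeasure] [μY.Regular]` ((6e)'s frame; Mathlib `distribHaarChar_mul` wants both)
open scoped Classical in
include hw in
/-- **THE (R-b) LETTER OF RECORD `hRb` (R90-C10-p01 (g3) 02:28:49Z BYTES).**  `v` non-split (`hns`), RAMIFIED at `w` (`he`), TAME (`|2|_w = 1`); `ϖ` a uniformiser of `L_w`;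
`χ₁ : (L ⊗ L⁺_v)ˣ → ℂˣ` continuous (`h₁`), contracting (`hcontr`), in BRANCH B (`hB`: `χ₁(u·σu) = 1` on the units of valuation one); `Π = piU` a uniformiser unit
(`|Π_{w′}| = exp(−1)`); conductor data `m ≥ 1`, `ν + ν = m + 1` (even conductor), a level-`m` witness `u₁` (`|u₁ − 1|_{w′} ≤ |ϖ|ᵐ`, `χ₁ u₁ ≠ 1`); `⅟2` the tame base
constant; an auxiliary regular additive Haar measure `μ⁻` (`μY`) of `R⁻`; a Haar measure `μ` of `N(L⁺_v)`; and the FOUR VALUE LETTERS of ruling R-S1-29 on the level-one sphere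
integral `Φ(a′) = ∫_{|s_w| = exp(−1)} Ē(a′ − s) dμ⁻` along the base family `a′ = (σΠ·Π)ᵗ·(−(xσx)·½)`: `hΦdeep` (deep: `Φ = 0`), `hΦcritC` (critical: `Φ = Φcrit`), `hΦsh`
(shallow: `Φ = 0`), and the Gauss square `hΦcrit : Φcrit²·X = (N𝔭_v)⁻¹·μ⁻{|y|_w ≤ 1}²` (`X = χ₁(σΠ·Π)`).  THEN, with `F₀(n) = χ₁((σẑ)⁻¹)·‖ẑ‖⁻¹` (`z = n₀₂`),
`Sh_j ∩ cut ν = {|z|_w = eʲ ∧ |x|_w ≤ e^{j−ν}}` (★ (6c) bytes), `q := N𝔓_w`, `B(ν,0) = {|z|_w ≤ |ϖ|⁰ ∧ |x|_w ≤ |ϖ|^ν}`: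
**`(∀ j₀ j, j₀ ≤ j → Even j → ∫_{Sh_j ∩ cut ν} F₀ dμ = 0) ∧ ∃ C, (∀ j κ, j = 2κ+1 → ∫_{Sh_j ∩ cut ν} F₀ dμ = C·X^{κ+1}) ∧ C²·X = (q^ν·μ(B(ν,0)))²·((q−1)²·(q^{2ν+1})⁻¹)`.**
Proof: ★ (6d) `evenShells_zero_and_exists_const_oddShells_of_rows` at `X := χ₁(σΠ·Π)`, `Φdeep := 0`, `c := ⅟2` (`σ½ + ½ = 1`, `|½|_w ≤ 1`), an auxiliary `μ_R := addHaar`, fed the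
three rows (6e) `fibreRows_hi ∕ _mid ∕ _lo` at `l := σΠ·Π` (its letters by ★ P1 §0′ `scalingUnit_letters_conj_mul_ram`), `hfixP` by ★ `apply_eq_one_of_branchB_of_fixed_principal_ram`.
[cite: Keys1984, §4–§5, §7 Theorem (2) (d) p. 126] [cite: Casselman1980, §3] [cite: Rogawski1990, §1.10 p. 9, §12.2 (2) p. 173] [cite: WeilBNT1967, Ch. II §5] -/
theorem shellLaw_of_values (hns : ∀ w' : PlacesOver L v, IsCMField.complexConj L • w'.1 = w'.1)
    (he : v.asIdeal.ramificationIdx' w.1.asIdeal ≠ 1) (h2w : Valued.v (2 : w.1.adicCompletion L) = 1)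
    {ϖ : w.1.adicCompletion L} (hϖ : Valued.v ϖ = WithZero.exp (-1 : ℤ))
    (χ₁ : (LocalRing L v)ˣ →* ℂˣ) (h₁ : Continuous fun x => ((χ₁ x : ℂˣ) : ℂ))
    (hcontr : ∀ x : (LocalRing L v)ˣ, unitModulusChar (LocalRing L v) x < 1 → ‖((χ₁ x : ℂˣ) : ℂ)‖ < 1)
    (hB : ∀ u : (LocalRing L v)ˣ, (∀ w' : PlacesOver L v, Valued.v ((u : LocalRing L v) w') = 1) →
      χ₁ (u * Units.map (conjLocal L (IsCMField.complexConj L) v : LocalRing L v →* LocalRing L v) u) = 1)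
    (piU : (LocalRing L v)ˣ) (hpiU : ∀ w' : PlacesOver L v, Valued.v ((piU : LocalRing L v) w') = WithZero.exp (-1 : ℤ))
    {m ν : ℕ} (hm : 1 ≤ m) (hνν : ν + ν = m + 1)
    (u₁ : (LocalRing L v)ˣ) (hu₁ : ∀ w' : PlacesOver L v, Valued.v (((u₁ : LocalRing L v) w') - 1) ≤ Valued.v ϖ ^ m) (hχu₁ : χ₁ u₁ ≠ 1)
    [Invertible (2 : LocalRing L v)]
    [MeasurableSpace (LocalRing L v)] [BorelSpace (LocalRing L v)]
    (μY : Measure ↥(HeisRing.skewPart (conjLocal L (IsCMField.complexConj L) v))) [μY.IsAddHaarMeasure] [μY.Regular]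
    [MeasurableSpace ↥(cmBorelTriple L 3 v).N] [BorelSpace ↥(cmBorelTriple L 3 v).N] (μ : Measure ↥(cmBorelTriple L 3 v).N) [μ.IsHaarMeasure]
    (Φcrit : ℂ)
    (hΦdeep : ∀ (t : ℕ) (x : LocalRing L v),
      Valued.v ((((((Units.map (conjLocal L (IsCMField.complexConj L) v : LocalRing L v →* LocalRing L v) piU * piU) ^ t : (LocalRing L v)ˣ)) : LocalRing L v) *
          (-(x * conjLocal L (IsCMField.complexConj L) v x) * ⅟(2 : LocalRing L v))) w) ≤ Valued.v ϖ ^ (m + 2) →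
      ∫ s in {s : ↥(HeisRing.skewPart (conjLocal L (IsCMField.complexConj L) v)) | Valued.v ((s : LocalRing L v) w) = WithZero.exp (-1 : ℤ)},
          (fun r : LocalRing L v => if h : IsUnit r then (((χ₁ h.unit)⁻¹ : ℂˣ) : ℂ) else 0)
            (((((Units.map (conjLocal L (IsCMField.complexConj L) v : LocalRing L v →* LocalRing L v) piU * piU) ^ t : (LocalRing L v)ˣ)) : LocalRing L v) *
              (-(x * conjLocal L (IsCMField.complexConj L) v x) * ⅟(2 : LocalRing L v)) - (s : LocalRing L v)) ∂μY = 0)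
    (hΦcritC : ∀ (t : ℕ) (x : LocalRing L v),
      Valued.v ((((((Units.map (conjLocal L (IsCMField.complexConj L) v : LocalRing L v →* LocalRing L v) piU * piU) ^ t : (LocalRing L v)ˣ)) : LocalRing L v) *
          (-(x * conjLocal L (IsCMField.complexConj L) v x) * ⅟(2 : LocalRing L v))) w) = Valued.v ϖ ^ (m + 1) →
      ∫ s in {s : ↥(HeisRing.skewPart (conjLocal L (IsCMField.complexConj L) v)) | Valued.v ((s : LocalRing L v) w) = WithZero.exp (-1 : ℤ)},
          (fun r : LocalRing L v => if h : IsUnit r then (((χ₁ h.unit)⁻¹ : ℂˣ) : ℂ) else 0)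
            (((((Units.map (conjLocal L (IsCMField.complexConj L) v : LocalRing L v →* LocalRing L v) piU * piU) ^ t : (LocalRing L v)ˣ)) : LocalRing L v) *
              (-(x * conjLocal L (IsCMField.complexConj L) v x) * ⅟(2 : LocalRing L v)) - (s : LocalRing L v)) ∂μY = Φcrit)
    (hΦsh : ∀ (t : ℕ) (x : LocalRing L v),
      Valued.v ϖ ^ (m + 1) < Valued.v ((((((Units.map (conjLocal L (IsCMField.complexConj L) v : LocalRing L v →* LocalRing L v) piU * piU) ^ t : (LocalRing L v)ˣ)) : LocalRing L v) *
          (-(x * conjLocal L (IsCMField.complexConj L) v x) * ⅟(2 : LocalRing L v))) w) →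
      Valued.v ((((((Units.map (conjLocal L (IsCMField.complexConj L) v : LocalRing L v →* LocalRing L v) piU * piU) ^ t : (LocalRing L v)ˣ)) : LocalRing L v) *
          (-(x * conjLocal L (IsCMField.complexConj L) v x) * ⅟(2 : LocalRing L v))) w) ≤ Valued.v ϖ ^ 2 →
      ∫ s in {s : ↥(HeisRing.skewPart (conjLocal L (IsCMField.complexConj L) v)) | Valued.v ((s : LocalRing L v) w) = WithZero.exp (-1 : ℤ)},
          (fun r : LocalRing L v => if h : IsUnit r then (((χ₁ h.unit)⁻¹ : ℂˣ) : ℂ) else 0)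
            (((((Units.map (conjLocal L (IsCMField.complexConj L) v : LocalRing L v →* LocalRing L v) piU * piU) ^ t : (LocalRing L v)ˣ)) : LocalRing L v) *
              (-(x * conjLocal L (IsCMField.complexConj L) v x) * ⅟(2 : LocalRing L v)) - (s : LocalRing L v)) ∂μY = 0)
    (hΦcrit : Φcrit ^ 2 * ((χ₁ (Units.map (conjLocal L (IsCMField.complexConj L) v : LocalRing L v →* LocalRing L v) piU * piU) : ℂˣ) : ℂ) =
      (((Ideal.absNorm v.asIdeal : ℝ) : ℂ))⁻¹ *
        ((μY.real {y : ↥(HeisRing.skewPart (conjLocal L (IsCMField.complexConj L) v)) | Valued.v ((y : LocalRing L v) w) ≤ 1} : ℝ) : ℂ) ^ 2) :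
    (∀ j₀ j : ℕ, j₀ ≤ j → Even j → ∫ n in {m : ↥(cmBorelTriple L 3 v).N |
        Valued.v (((((m : ↥(unitaryGroupOfForm (conjLocal L (IsCMField.complexConj L) v) (cmLocalForm L 3 v))) : GL (Fin 3) (LocalRing L v)) : Matrix (Fin 3) (Fin 3) (LocalRing L v)) 0 2) w) = WithZero.exp (j : ℤ) ∧
        Valued.v (((((m : ↥(unitaryGroupOfForm (conjLocal L (IsCMField.complexConj L) v) (cmLocalForm L 3 v))) : GL (Fin 3) (LocalRing L v)) : Matrix (Fin 3) (Fin 3) (LocalRing L v)) 0 1) w) ≤ WithZero.exp ((j : ℤ) - ν)},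
        (fun n : ↥(cmBorelTriple L 3 v).N =>
          if h : IsUnit ((((n : ↥(unitaryGroupOfForm (conjLocal L (IsCMField.complexConj L) v) (cmLocalForm L 3 v))) : GL (Fin 3) (LocalRing L v)) : Matrix (Fin 3) (Fin 3) (LocalRing L v)) 0 2) then
            ((((χ₁ (Units.map ((conjLocal L (IsCMField.complexConj L) v) : LocalRing L v →* LocalRing L v) h.unit))⁻¹ : ℂˣ) : ℂ) *
              ((((unitModulusChar (LocalRing L v) h.unit)⁻¹ : ℝ≥0) : ℝ) : ℂ))
          else 0) n ∂μ = 0) ∧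
    ∃ C : ℂ,
      (∀ j κ : ℕ, j = 2 * κ + 1 → ∫ n in {m : ↥(cmBorelTriple L 3 v).N |
          Valued.v (((((m : ↥(unitaryGroupOfForm (conjLocal L (IsCMField.complexConj L) v) (cmLocalForm L 3 v))) : GL (Fin 3) (LocalRing L v)) : Matrix (Fin 3) (Fin 3) (LocalRing L v)) 0 2) w) = WithZero.exp (j : ℤ) ∧
          Valued.v (((((m : ↥(unitaryGroupOfForm (conjLocal L (IsCMField.complexConj L) v) (cmLocalForm L 3 v))) : GL (Fin 3) (LocalRing L v)) : Matrix (Fin 3) (Fin 3) (LocalRing L v)) 0 1) w) ≤ WithZero.exp ((j : ℤ) - ν)},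
          (fun n : ↥(cmBorelTriple L 3 v).N =>
            if h : IsUnit ((((n : ↥(unitaryGroupOfForm (conjLocal L (IsCMField.complexConj L) v) (cmLocalForm L 3 v))) : GL (Fin 3) (LocalRing L v)) : Matrix (Fin 3) (Fin 3) (LocalRing L v)) 0 2) then
              ((((χ₁ (Units.map ((conjLocal L (IsCMField.complexConj L) v) : LocalRing L v →* LocalRing L v) h.unit))⁻¹ : ℂˣ) : ℂ) *
                ((((unitModulusChar (LocalRing L v) h.unit)⁻¹ : ℝ≥0) : ℝ) : ℂ))
            else 0) n ∂μ =
          C * ((χ₁ (Units.map (conjLocal L (IsCMField.complexConj L) v : LocalRing L v →* LocalRing L v) piU * piU) : ℂˣ) : ℂ) ^ (κ + 1)) ∧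
      C ^ 2 * ((χ₁ (Units.map (conjLocal L (IsCMField.complexConj L) v : LocalRing L v →* LocalRing L v) piU * piU) : ℂˣ) : ℂ) =
        (((Ideal.absNorm w.1.asIdeal : ℝ) : ℂ) ^ ν *
          ((μ.real {m : ↥(cmBorelTriple L 3 v).N | Valued.v (((((m : ↥(unitaryGroupOfForm (conjLocal L (IsCMField.complexConj L) v) (cmLocalForm L 3 v))) : GL (Fin 3) (LocalRing L v)) : Matrix (Fin 3) (Fin 3) (LocalRing L v)) 0 2) w) ≤ Valued.v ϖ ^ (0 : ℕ) ∧
            Valued.v (((((m : ↥(unitaryGroupOfForm (conjLocal L (IsCMField.complexConj L) v) (cmLocalForm L 3 v))) : GL (Fin 3) (LocalRing L v)) : Matrix (Fin 3) (Fin 3) (LocalRing L v)) 0 1) w) ≤ Valued.v ϖ ^ ν} : ℝ) : ℂ)) ^ 2 *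
        ((((Ideal.absNorm w.1.asIdeal : ℝ) : ℂ) - 1) ^ 2 * ((((Ideal.absNorm w.1.asIdeal : ℝ) : ℂ)) ^ (2 * ν + 1))⁻¹) := by
  haveI : SecondCountableTopology (LocalRing L v) := secondCountableTopology_localRing (E := L) v
  -- an auxiliary regular additive Haar measure of `R` (the rows do not see it; ★ (6d) integrates the `x`-masses against it)
  obtain ⟨μX, hμX⟩ : ∃ μ' : Measure (LocalRing L v), μ' = Measure.addHaar := ⟨_, rfl⟩
  haveI : μX.IsAddHaarMeasure := by rw [hμX]; infer_instance
  haveI : μX.Regular := by rw [hμX]; infer_instance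
  -- J1: the letters of the scaling unit `l := σΠ·Π` (★ (6b) P1 §0′)
  obtain ⟨hlσ, hlv, hlm⟩ := BposRamShellFibres.scalingUnit_letters_conj_mul_ram L v w hw he piU hpiU
  -- J4: the tame base constant `c := ½`
  have hcσ : conjLocal L (IsCMField.complexConj L) v (⅟ (2 : LocalRing L v)) = ⅟ (2 : LocalRing L v) := HeisRing.map_invOf_two _
  have hc : conjLocal L (IsCMField.complexConj L) v (⅟ (2 : LocalRing L v)) + ⅟ (2 : LocalRing L v) = 1 := by rw [hcσ, invOf_two_add_invOf_two]
  have hcw : Valued.v ((⅟ (2 : LocalRing L v)) w) = 1 := valued_invOf_two_apply L v w h2w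
  -- Branch B ⇒ `χ₁ = 1` on the σ-fixed principal units (the letter `hfixP` of (6e))
  have hfixP := BposRamFixedPrincipalUnits.apply_eq_one_of_branchB_of_fixed_principal_ram L v w h2w χ₁ hB
  -- ★ (6d) at `X := χ₁(σΠ·Π)`, `Φdeep := 0`, fed the three (6e) rows BY NAME
  exact BposRamOddShellValues.evenShells_zero_and_exists_const_oddShells_of_rows L v w hw hns he h2w χ₁ h₁ hcontr μX μY μ hϖ hc hcw.le hνν
    ((χ₁ (Units.map (conjLocal L (IsCMField.complexConj L) v : LocalRing L v →* LocalRing L v) piU * piU) : ℂˣ) : ℂ) 0 Φcrit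
    (BposRamFibreRows.fibreRows_hi L v w hw μY χ₁ h₁ hfixP hϖ hm u₁ hu₁ hχu₁ _ hlσ hlv hlm hcσ hcw 0 he h2w hΦdeep)
    (BposRamFibreRows.fibreRows_mid L v w hw μY χ₁ h₁ hfixP hϖ hm u₁ hu₁ hχu₁ _ hlσ hlv hlm hcσ hcw Φcrit he h2w hΦcritC)
    (BposRamFibreRows.fibreRows_lo L v w hw μY χ₁ h₁ hfixP hϖ hm u₁ hu₁ hχu₁ _ hlσ hlv hlm hcσ hcw he h2w hΦsh)
    rfl hΦcrit

end Summit.HodgeConjecture.HodgeConjecture.R90.S1.BposRamShellLawOfRecord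

end
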